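import Summits.MatrixMultiplication.MatrixMultiplication.Theorems.SoloInformedValPairPacking
import Mathlib.Analysis.MeanInequalities

/-!
# SoloInformedValLocalChain — the local route to the packing inequality: (U8) ⟹ (U7) ⟹ (U6) ⟹ T³ ≤ n²·|I|·|J|·|K|

Sequel of `SoloInformedValVertexDegree` / `SoloInformedValPairPacking` (dossier `paper/val-superlinear.md`
§15.8).  The PACKING QUESTION (U2𝒩) for normal-form triples asks whether `T³ ≤ n² |I| |J| |K|` (`n = |G|`,
`T` = number of triangles).  This file contains NO group theory: it is the bookkeeping half of the local route,
valid for an arbitrary finite set `S ⊆ I × J × K` of "triangles" with vertex degrees `t_v` (number of members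
of `S` through `v`):

* `TwoStepPackingI n S` — the TWO-STEP LOCAL PACKING HYPOTHESIS (U8) at the `I`-vertices: for every `i`, the
  `J`-neighbours of `i` (vertices `j` with some `(i, j, k) ∈ S`) carry at most `n` members of `S` in total, and
  likewise the `K`-neighbours;
* `sum_link_degProd_le` — (U8) ⟹ (U7): `P(i) = ∑_{(i,j,k) ∈ S} t_j t_k ≤ n²` for every `i`;
* `sum_degProd_le` — (U7) ⟹ (U6): `∑_{(i,j,k) ∈ S} t_i t_j t_k ≤ n² · |S|`;
* `card_pow_four_le` — the entropy / AM–GM inequality `|S|⁴ ≤ |I'| |J'| |K'| · ∑_{S} t_i t_j t_k`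
  (`I', J', K'` the vertices actually used; equality for complete blocks);
* `card_cube_le_of_twoStepPacking` — hence (U8) ⟹ `|S|³ ≤ n² |I'| |J'| |K'|`, i.e. (U2𝒩) for `S`;
* `card_le_of_universal` — (U8) ⟹ a vertex adjacent to every used `J`-vertex forces `|S| ≤ n`;
* `card_triangleSet_cube_le_of_twoStepPacking` — the instantiation for the triangle set of three pair graphs.

For the triangle set of a normal-form triple without accidental solutions, (U8) with `n = |G|` is OPEN
(dossier (15.8)(b′), claim c551; its case of two neighbours is `NoAccidental.degree_add_degree_le` up to the
cyclic symmetry of the classes); the pointwise form `t_i t_j t_k ≤ n²` is false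
(`localDegreeProduct_counterexample`).  So this file reduces (U2𝒩) on that class to the single local
statement (U8).

solo-informed MatrixMultiplication, gen 77.  Elementary; no `sorry`.
-/

namespace Summit.MatrixMultiplication.MatrixMultiplication.Theorems.SoloVal

open Finset

section LocalChain

variable {I J K : Type*}

/-- Number of members of `S` through the `I`-vertex `i`. -/
def degI [DecidableEq I] (S : Finset (I × J × K)) (i : I) : ℕ := (S.filter (fun τ => τ.1 = i)).card
/-- Number of members of `S` through the `J`-vertex `j`. -/
def degJ [DecidableEq J] (S : Finset (I × J × K)) (j : J) : ℕ := (S.filter (fun τ => τ.2.1 = j)).card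
/-- Number of members of `S` through the `K`-vertex `k`. -/
def degK [DecidableEq K] (S : Finset (I × J × K)) (k : K) : ℕ := (S.filter (fun τ => τ.2.2 = k)).card
/-- The `J`-neighbours of `i`: vertices `j` with some `(i, j, k) ∈ S`. -/
def nbJ [DecidableEq I] [DecidableEq J] (S : Finset (I × J × K)) (i : I) : Finset J :=
  (S.filter (fun τ => τ.1 = i)).image (fun τ => τ.2.1)
/-- The `K`-neighbours of `i`: vertices `k` with some `(i, j, k) ∈ S`. -/
def nbK [DecidableEq I] [DecidableEq K] (S : Finset (I × J × K)) (i : I) : Finset K :=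
  (S.filter (fun τ => τ.1 = i)).image (fun τ => τ.2.2)

/-- (U8) at the `I`-vertices — TWO-STEP LOCAL PACKING with constant `n`: the `J`-neighbours of any `i` carry at
most `n` members of `S` in total, and so do its `K`-neighbours. -/
def TwoStepPackingI [DecidableEq I] [DecidableEq J] [DecidableEq K] (n : ℕ) (S : Finset (I × J × K)) : Prop :=
  ∀ i, ∑ j ∈ nbJ S i, degJ S j ≤ n ∧ ∑ k ∈ nbK S i, degK S k ≤ n

/-- Every member of `S` is counted in the `I`-degree of its `I`-vertex. -/
theorem one_le_degI [DecidableEq I] {S : Finset (I × J × K)} {τ : I × J × K} (hτ : τ ∈ S) :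
    1 ≤ degI S τ.1 :=
  card_pos.mpr ⟨τ, mem_filter.mpr ⟨hτ, rfl⟩⟩
/-- Every member of `S` is counted in the `J`-degree of its `J`-vertex. -/
theorem one_le_degJ [DecidableEq J] {S : Finset (I × J × K)} {τ : I × J × K} (hτ : τ ∈ S) :
    1 ≤ degJ S τ.2.1 :=
  card_pos.mpr ⟨τ, mem_filter.mpr ⟨hτ, rfl⟩⟩
/-- Every member of `S` is counted in the `K`-degree of its `K`-vertex. -/
theorem one_le_degK [DecidableEq K] {S : Finset (I × J × K)} {τ : I × J × K} (hτ : τ ∈ S) :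
    1 ≤ degK S τ.2.2 :=
  card_pos.mpr ⟨τ, mem_filter.mpr ⟨hτ, rfl⟩⟩

/-- (U8) ⟹ (U7): the link sum `P(i) = ∑_{(i,j,k) ∈ S} t_j · t_k` is at most `n²`.  (The link of `i` embeds in
`nbJ S i × nbK S i`, over which the sum factorises.) -/
theorem sum_link_degProd_le [DecidableEq I] [DecidableEq J] [DecidableEq K] {n : ℕ}
    {S : Finset (I × J × K)} (h : TwoStepPackingI n S) (i : I) :
    ∑ τ ∈ S.filter (fun τ => τ.1 = i), degJ S τ.2.1 * degK S τ.2.2 ≤ n ^ 2 := by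
  have hinj : Set.InjOn (fun τ : I × J × K => τ.2) ↑(S.filter (fun τ => τ.1 = i)) := by
    intro τ hτ τ' hτ' heq
    have h1 : τ.1 = i := (mem_filter.mp (mem_coe.mp hτ)).2
    have h1' : τ'.1 = i := (mem_filter.mp (mem_coe.mp hτ')).2
    exact Prod.ext (h1.trans h1'.symm) heq
  have hsub : (S.filter (fun τ => τ.1 = i)).image (fun τ => τ.2) ⊆ nbJ S i ×ˢ nbK S i := by
    intro e he
    obtain ⟨τ, hτ, rfl⟩ := mem_image.mp he
    exact mem_product.mpr ⟨mem_image.mpr ⟨τ, hτ, rfl⟩, mem_image.mpr ⟨τ, hτ, rfl⟩⟩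
  calc ∑ τ ∈ S.filter (fun τ => τ.1 = i), degJ S τ.2.1 * degK S τ.2.2
      = ∑ e ∈ (S.filter (fun τ => τ.1 = i)).image (fun τ => τ.2), degJ S e.1 * degK S e.2 := by
        rw [sum_image hinj]
    _ ≤ ∑ e ∈ nbJ S i ×ˢ nbK S i, degJ S e.1 * degK S e.2 := sum_le_sum_of_subset hsub
    _ = (∑ j ∈ nbJ S i, degJ S j) * (∑ k ∈ nbK S i, degK S k) := by
        rw [sum_product, sum_mul_sum]
    _ ≤ n * n := Nat.mul_le_mul (h i).1 (h i).2
    _ = n ^ 2 := (sq n).symm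

/-- (U7) ⟹ (U6): `∑_{(i,j,k) ∈ S} t_i t_j t_k ≤ n² · |S|`. -/
theorem sum_degProd_le [DecidableEq I] [DecidableEq J] [DecidableEq K] {n : ℕ} {S : Finset (I × J × K)}
    (h7 : ∀ i, ∑ τ ∈ S.filter (fun τ => τ.1 = i), degJ S τ.2.1 * degK S τ.2.2 ≤ n ^ 2) :
    ∑ τ ∈ S, degI S τ.1 * degJ S τ.2.1 * degK S τ.2.2 ≤ n ^ 2 * S.card := by
  have hmaps : ∀ τ ∈ S, (fun τ : I × J × K => τ.1) τ ∈ S.image (fun τ => τ.1) :=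
    fun τ hτ => mem_image_of_mem _ hτ
  rw [← sum_fiberwise_of_maps_to hmaps, card_eq_sum_card_fiberwise hmaps, mul_sum]
  refine sum_le_sum fun i _ => ?_
  calc ∑ τ ∈ S.filter (fun τ => τ.1 = i), degI S τ.1 * degJ S τ.2.1 * degK S τ.2.2
      = ∑ τ ∈ S.filter (fun τ => τ.1 = i), degI S i * (degJ S τ.2.1 * degK S τ.2.2) := by
        refine sum_congr rfl fun τ hτ => ?_
        rw [(mem_filter.mp hτ).2, mul_assoc]
    _ = degI S i * ∑ τ ∈ S.filter (fun τ => τ.1 = i), degJ S τ.2.1 * degK S τ.2.2 := by rw [mul_sum]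
    _ ≤ degI S i * n ^ 2 := Nat.mul_le_mul_left _ (h7 i)
    _ = n ^ 2 * (S.filter (fun τ => τ.1 = i)).card := by rw [mul_comm]; rfl

/-- (U8) ⟹ `|S| ≤ n` as soon as some `I`-vertex is adjacent to every `J`-vertex that `S` uses
("a full two-step neighbourhood is linear"). -/
theorem card_le_of_universal [DecidableEq I] [DecidableEq J] [DecidableEq K] {n : ℕ}
    {S : Finset (I × J × K)} (h : TwoStepPackingI n S) {i₀ : I}
    (huniv : S.image (fun τ => τ.2.1) ⊆ nbJ S i₀) : S.card ≤ n := by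
  have hmaps : ∀ τ ∈ S, (fun τ : I × J × K => τ.2.1) τ ∈ nbJ S i₀ :=
    fun τ hτ => huniv (mem_image_of_mem _ hτ)
  rw [card_eq_sum_card_fiberwise hmaps]
  exact (h i₀).1

/-! ### The entropy inequality `|S|⁴ ≤ |I'| |J'| |K'| · ∑ t_i t_j t_k` -/

/-- Weighted AM–GM in the form used three times below: if `t` is positive on `A` with `∑_A t = T > 0`, then
`T / |A| ≤ ∏_{a ∈ A} t(a) ^ (t(a) / T)`. -/
theorem div_card_le_prod_rpow {α : Type*} (A : Finset α) (t : α → ℕ)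
    (hpos : ∀ a ∈ A, 1 ≤ t a) {T : ℕ} (hT : ∑ a ∈ A, t a = T) (hTpos : 0 < T) :
    (T : ℝ) / A.card ≤ ∏ a ∈ A, (t a : ℝ) ^ ((t a : ℝ) / T) := by
  have hA : A.Nonempty := by
    rw [nonempty_iff_ne_empty]
    rintro rfl
    rw [sum_empty] at hT
    omega
  have hTr : (0 : ℝ) < T := by exact_mod_cast hTpos
  have hT0 : (T : ℝ) ≠ 0 := hTr.ne'
  have hw : ∑ a ∈ A, (t a : ℝ) / T = 1 := by
    rw [← sum_div, ← Nat.cast_sum, hT, div_self hT0]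
  -- AM–GM with weights `t/T` and values `1/t`
  have key := Real.geom_mean_le_arith_mean_weighted A (fun a => (t a : ℝ) / T) (fun a => ((t a : ℝ))⁻¹)
    (fun a _ => by positivity) hw (fun a _ => by positivity)
  have hrhs : ∑ a ∈ A, (t a : ℝ) / T * ((t a : ℝ))⁻¹ = A.card / T := by
    rw [show (A.card : ℝ) / T = ∑ _a ∈ A, (1 : ℝ) / T by rw [sum_const, nsmul_eq_mul, mul_one_div]]
    refine sum_congr rfl fun a ha => ?_
    have hta : (t a : ℝ) ≠ 0 := by have := hpos a ha; positivity
    rw [div_mul_eq_mul_div, mul_inv_cancel₀ hta]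
  have hlhs : ∏ a ∈ A, ((t a : ℝ))⁻¹ ^ ((t a : ℝ) / T) = (∏ a ∈ A, (t a : ℝ) ^ ((t a : ℝ) / T))⁻¹ := by
    rw [← prod_inv_distrib]
    refine prod_congr rfl fun a _ => ?_
    exact Real.inv_rpow (by positivity) _
  rw [hrhs, hlhs] at key
  have hP : 0 < ∏ a ∈ A, (t a : ℝ) ^ ((t a : ℝ) / T) :=
    prod_pos fun a ha => Real.rpow_pos_of_pos (by have := hpos a ha; positivity) _
  have hQ : (0 : ℝ) < A.card / T := by have := hA.card_pos; positivity
  have := (inv_le_comm₀ hP hQ).mp key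
  rwa [inv_div] at this

/-- Regrouping a geometric mean along the fibres of `g`:
`∏_{τ ∈ S} f(g τ) ^ (1/T) = ∏_{b ∈ g(S)} f(b) ^ (#fibre(b) / T)`. -/
theorem prod_rpow_comp {β γ : Type*} [DecidableEq γ] (S : Finset β) (g : β → γ) (f : γ → ℝ)
    (hf : ∀ τ ∈ S, 0 ≤ f (g τ)) (T : ℝ) :
    ∏ τ ∈ S, f (g τ) ^ (1 / T)
      = ∏ b ∈ S.image g, f b ^ (((S.filter (fun τ => g τ = b)).card : ℝ) / T) := by
  rw [prod_comp (s := S) (fun c => f c ^ (1 / T)) g]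
  refine prod_congr rfl fun b hb => ?_
  obtain ⟨τ, hτ, rfl⟩ := mem_image.mp hb
  rw [← Real.rpow_natCast, ← Real.rpow_mul (hf τ hτ)]
  congr 1
  ring

/-- THE ENTROPY INEQUALITY.  For every finite `S ⊆ I × J × K`:
`|S|⁴ ≤ |I'| · |J'| · |K'| · ∑_{(i,j,k) ∈ S} t_i t_j t_k`, where `I', J', K'` are the sets of vertices used by
`S` (equality for complete blocks `S = I' × J' × K'`).  Proof: AM–GM over `S`, then weighted AM–GM per class. -/
theorem card_pow_four_le [DecidableEq I] [DecidableEq J] [DecidableEq K] (S : Finset (I × J × K)) :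
    ((S.card : ℝ)) ^ 4 ≤ (S.image (fun τ => τ.1)).card * (S.image (fun τ => τ.2.1)).card
      * (S.image (fun τ => τ.2.2)).card
      * ∑ τ ∈ S, ((degI S τ.1 : ℝ) * degJ S τ.2.1 * degK S τ.2.2) := by
  rcases S.eq_empty_or_nonempty with hS | hS
  · simp [hS]
  set T := S.card with hTdef
  have hTpos : 0 < T := hS.card_pos
  have hTr : (0 : ℝ) < T := by exact_mod_cast hTpos
  set I' := S.image (fun τ => τ.1) with hI'def
  set J' := S.image (fun τ => τ.2.1) with hJ'def
  set K' := S.image (fun τ => τ.2.2) with hK'def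
  set f : I × J × K → ℝ := fun τ => (degI S τ.1 : ℝ) * degJ S τ.2.1 * degK S τ.2.2 with hfdef
  have hfnn : ∀ τ ∈ S, 0 ≤ f τ := fun τ _ => by rw [hfdef]; positivity
  -- Step A: unweighted AM–GM over S
  have hw : ∑ _τ ∈ S, (1 : ℝ) / T = 1 := by
    rw [sum_const, nsmul_eq_mul, mul_one_div, div_self hTr.ne']
  have hA := Real.geom_mean_le_arith_mean_weighted S (fun _ => (1 : ℝ) / T) f (fun _ _ => by positivity)
    hw hfnn
  -- Step B: split the geometric mean into the three classes
  have hB : ∏ τ ∈ S, f τ ^ ((1 : ℝ) / T)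
      = (∏ τ ∈ S, (degI S τ.1 : ℝ) ^ ((1 : ℝ) / T)) * (∏ τ ∈ S, (degJ S τ.2.1 : ℝ) ^ ((1 : ℝ) / T))
        * (∏ τ ∈ S, (degK S τ.2.2 : ℝ) ^ ((1 : ℝ) / T)) := by
    rw [← prod_mul_distrib, ← prod_mul_distrib]
    refine prod_congr rfl fun τ _ => ?_
    have h1 : (0 : ℝ) ≤ (degI S τ.1 : ℝ) := Nat.cast_nonneg _
    have h2 : (0 : ℝ) ≤ (degJ S τ.2.1 : ℝ) := Nat.cast_nonneg _
    have h3 : (0 : ℝ) ≤ (degK S τ.2.2 : ℝ) := Nat.cast_nonneg _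
    simp only [hfdef]
    rw [Real.mul_rpow (mul_nonneg h1 h2) h3, Real.mul_rpow h1 h2]
  -- Steps C + D: each class factor is at least T / (number of vertices used)
  have hsumI : ∑ i ∈ I', degI S i = T :=
    (card_eq_sum_card_fiberwise fun τ hτ => mem_image_of_mem (fun τ : I × J × K => τ.1) hτ).symm
  have hsumJ : ∑ j ∈ J', degJ S j = T :=
    (card_eq_sum_card_fiberwise fun τ hτ => mem_image_of_mem (fun τ : I × J × K => τ.2.1) hτ).symm
  have hsumK : ∑ k ∈ K', degK S k = T :=
    (card_eq_sum_card_fiberwise fun τ hτ => mem_image_of_mem (fun τ : I × J × K => τ.2.2) hτ).symm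
  have hI : (T : ℝ) / I'.card ≤ ∏ τ ∈ S, (degI S τ.1 : ℝ) ^ ((1 : ℝ) / T) := by
    rw [prod_rpow_comp S (fun τ => τ.1) (fun i => (degI S i : ℝ)) (fun _ _ => Nat.cast_nonneg _)]
    exact div_card_le_prod_rpow I' (degI S)
      (fun i hi => by obtain ⟨τ, hτ, rfl⟩ := mem_image.mp hi; exact one_le_degI hτ) hsumI hTpos
  have hJ : (T : ℝ) / J'.card ≤ ∏ τ ∈ S, (degJ S τ.2.1 : ℝ) ^ ((1 : ℝ) / T) := by
    rw [prod_rpow_comp S (fun τ => τ.2.1) (fun j => (degJ S j : ℝ)) (fun _ _ => Nat.cast_nonneg _)]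
    exact div_card_le_prod_rpow J' (degJ S)
      (fun j hj => by obtain ⟨τ, hτ, rfl⟩ := mem_image.mp hj; exact one_le_degJ hτ) hsumJ hTpos
  have hK : (T : ℝ) / K'.card ≤ ∏ τ ∈ S, (degK S τ.2.2 : ℝ) ^ ((1 : ℝ) / T) := by
    rw [prod_rpow_comp S (fun τ => τ.2.2) (fun k => (degK S k : ℝ)) (fun _ _ => Nat.cast_nonneg _)]
    exact div_card_le_prod_rpow K' (degK S)
      (fun k hk => by obtain ⟨τ, hτ, rfl⟩ := mem_image.mp hk; exact one_le_degK hτ) hsumK hTpos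
  have hI'pos : (0 : ℝ) < I'.card := by exact_mod_cast (hS.image _).card_pos
  have hJ'pos : (0 : ℝ) < J'.card := by exact_mod_cast (hS.image _).card_pos
  have hK'pos : (0 : ℝ) < K'.card := by exact_mod_cast (hS.image _).card_pos
  -- Step E: combine
  have h1 : (0 : ℝ) ≤ (T : ℝ) / I'.card := by positivity
  have h2 : (0 : ℝ) ≤ (T : ℝ) / J'.card := by positivity
  have h3 : (0 : ℝ) ≤ (T : ℝ) / K'.card := by positivity
  have hprod : (T : ℝ) / I'.card * ((T : ℝ) / J'.card) * ((T : ℝ) / K'.card)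
      ≤ ∑ τ ∈ S, (1 : ℝ) / T * f τ := by
    have hIJ := mul_le_mul hI hJ h2 (h1.trans hI)
    calc (T : ℝ) / I'.card * ((T : ℝ) / J'.card) * ((T : ℝ) / K'.card)
        ≤ (∏ τ ∈ S, (degI S τ.1 : ℝ) ^ ((1 : ℝ) / T)) * (∏ τ ∈ S, (degJ S τ.2.1 : ℝ) ^ ((1 : ℝ) / T))
          * (∏ τ ∈ S, (degK S τ.2.2 : ℝ) ^ ((1 : ℝ) / T)) :=
          mul_le_mul hIJ hK h3 ((mul_nonneg h1 h2).trans hIJ)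
      _ = ∏ τ ∈ S, f τ ^ ((1 : ℝ) / T) := hB.symm
      _ ≤ ∑ τ ∈ S, (1 : ℝ) / T * f τ := hA
  rw [← mul_sum] at hprod
  have hlhs : (T : ℝ) / I'.card * ((T : ℝ) / J'.card) * ((T : ℝ) / K'.card)
      = (T : ℝ) ^ 3 / (I'.card * J'.card * K'.card) := by
    rw [div_mul_div_comm, div_mul_div_comm]; ring
  have hM : (0 : ℝ) < I'.card * J'.card * K'.card := by positivity
  rw [hlhs, one_div, inv_mul_eq_div, div_le_iff₀ hM, div_mul_eq_mul_div, le_div_iff₀ hTr] at hprod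
  calc ((T : ℝ)) ^ 4 = (T : ℝ) ^ 3 * T := by ring
    _ ≤ (∑ τ ∈ S, f τ) * (I'.card * J'.card * K'.card) := hprod
    _ = _ := by ring

/-- THE LOCAL ROUTE, ASSEMBLED: two-step local packing (U8) with constant `n` implies the packing inequality
`|S|³ ≤ n² · |I'| · |J'| · |K'|` for the sets of vertices used. -/
theorem card_cube_le_of_twoStepPacking [DecidableEq I] [DecidableEq J] [DecidableEq K] {n : ℕ}
    {S : Finset (I × J × K)} (h : TwoStepPackingI n S) :
    S.card ^ 3 ≤ n ^ 2 * ((S.image (fun τ => τ.1)).card * (S.image (fun τ => τ.2.1)).card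
      * (S.image (fun τ => τ.2.2)).card) := by
  rcases S.eq_empty_or_nonempty with hS | hS
  · simp [hS]
  have hTr : (0 : ℝ) < S.card := by exact_mod_cast hS.card_pos
  have h6 := sum_degProd_le (fun i => sum_link_degProd_le h i)
  have h6r : ∑ τ ∈ S, ((degI S τ.1 : ℝ) * degJ S τ.2.1 * degK S τ.2.2) ≤ (n : ℝ) ^ 2 * S.card := by
    exact_mod_cast h6
  have h4 := card_pow_four_le S
  have hMnn : (0 : ℝ) ≤ (S.image (fun τ => τ.1)).card * (S.image (fun τ => τ.2.1)).card
      * (S.image (fun τ => τ.2.2)).card := by positivity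
  have h44 := h4.trans (mul_le_mul_of_nonneg_left h6r hMnn)
  have h3 : ((S.card : ℝ)) ^ 3 ≤ (n : ℝ) ^ 2 * ((S.image (fun τ => τ.1)).card
      * (S.image (fun τ => τ.2.1)).card * (S.image (fun τ => τ.2.2)).card) := by
    refine le_of_mul_le_mul_right ?_ hTr
    calc ((S.card : ℝ)) ^ 3 * S.card = (S.card : ℝ) ^ 4 := by ring
      _ ≤ _ := h44
      _ = _ := by ring
  exact_mod_cast h3

end LocalChain

section NormalForm

variable {G : Type*} [Fintype G]
variable {I J K : Type*} [Fintype I] [Fintype J] [Fintype K] [DecidableEq I] [DecidableEq J] [DecidableEq K]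
variable {HIJ : Finset (I × J)} {HJK : Finset (J × K)} {HKI : Finset (K × I)}

/-- For three pair graphs on finite classes: IF their triangle set satisfies two-step local packing (U8) with
constant `|G|` (open for normal-form triples in a finite abelian group `G`; dossier (15.8)(b′)), THEN the
packing inequality (U2𝒩) `T³ ≤ |G|² |I| |J| |K|` holds for it. -/
theorem card_triangleSet_cube_le_of_twoStepPacking
    (h : TwoStepPackingI (Fintype.card G) (triangleSet HIJ HJK HKI)) :
    (triangleSet HIJ HJK HKI).card ^ 3
      ≤ Fintype.card G ^ 2 * (Fintype.card I * Fintype.card J * Fintype.card K) := by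
  refine (card_cube_le_of_twoStepPacking h).trans (Nat.mul_le_mul_left _ ?_)
  exact Nat.mul_le_mul (Nat.mul_le_mul (card_le_univ _) (card_le_univ _)) (card_le_univ _)

end NormalForm

end Summit.MatrixMultiplication.MatrixMultiplication.Theorems.SoloVal
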